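import Mathlib
import HarnessLib
import Summits.QuantumFields.YangMills.Theorems.PencilRigidityCurvatureKernelBoundOddTorusCovCauchySchwarz
import Summits.QuantumFields.YangMills.Theorems.PencilRigidityCurvatureKernelBoundAxisDominationOfForm

/-!
# `CurvatureKernelBound` (stmt-QuantumFields-11687), line `sixteen-charts-analytic-kernel` — support: the axis covariance sequence is a
# positive-definite HANKEL sequence (transfer-matrix structure of the open stub E⁗ `AxisWindowBound`)

Helper file of the lead (prover-line-stmt-QuantumFields-11687-c4-0), `--supports stmt-QuantumFields-11687`. The open core of the crux in
axis currency (skeleton v13/v14, stub E⁗) bounds the sequence `m ↦ lCC(Q^θ, Q, m) = latticeConnectedCorr r.ρ β (2L+1) Q^θ Q m`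
(`Q = r.curvature.F` Wilson's corner action density, `Q^θ` its site-time-reflected variant). Here we record, from the landed odd-torus
site-reflection-positivity form (`oddTorusCov_integral_negReflect_mul_self_nonneg`, p127937) and the lead's lifted-observable bookkeeping
(`AxisDom.*`, p128805), that for `β ≥ 0` this sequence is POSITIVE-DEFINITE HANKEL on the heights that fit the positive half:
`0 ≤ Σᵢⱼ cᵢ cⱼ · lCC(Q^θ, Q, tᵢ + tⱼ)` for all real `cᵢ` and heights `tᵢ + 2 ≤ L` — the finite-volume transfer-matrix (Källén–Lehmann /
Hausdorff-moment) structure `lCC(Q^θ,Q,m) = ⟪Ω_Q, T^m Ω_Q⟫ − |⟪Ω,Ω_Q⟫|²` without constructing the transfer matrix. Proof: apply positivity of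
`Cov(X∘Θ′, X)` to `X = Σᵢ cᵢ Q_{tᵢe₀} ∘ lift`, expand bilinearly, and use `(Q_{te₀}∘lift)∘Θ′ = Q^θ_{−te₀}∘lift` plus torus translations.
[OsterwalderSeiler1978 §2; Seiler1982 Ch. 2; folklore]
-/

noncomputable section

open scoped BigOperators
open MeasureTheory
open Literature.MathematicalPhysics.QuantumLattice Literature.MathematicalPhysics.AQFT Literature.MathematicalPhysics.QuantumFieldTheory

namespace Summit.QuantumFields.YangMills.Theorems.CurvatureKernel

variable {G : Type} [Group G] [TopologicalSpace G] [IsTopologicalGroup G] [CompactSpace G] [MeasurableSpace G] [BorelSpace G]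

namespace AxisHankel

open AxisDom
open Literature.Probability.LatticeModels (Site)

/-- The site reflection of `t e₀` is `−t e₀`. [folklore] -/
theorem siteReflect_single_nat (t : ℕ) : siteReflect (Pi.single 0 (t : ℤ) : Site 4) = -Pi.single 0 (t : ℤ) := by
  funext k; rw [siteReflect_apply_ite]
  by_cases hk : k = 0
  · subst hk; simp
  · simp [hk]

/-- `t e₀ − (−s e₀) = (s + t) e₀` on `ℤ⁴`. [folklore] -/
theorem single_sub_neg_single (s t : ℕ) :
    (Pi.single 0 (t : ℤ) : Site 4) - -Pi.single 0 (s : ℤ) = Pi.single 0 (((s + t : ℕ)) : ℤ) := by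
  funext k
  by_cases hk : k = 0
  · subst hk; simp; ring
  · simp [hk]

end AxisHankel

open AxisDom AxisHankel in
/-- **The axis covariance sequence of the curvature channel is positive-definite Hankel** (support lemma for the open stub E⁗
`AxisWindowBound` of stmt-QuantumFields-11687): for `β ≥ 0`, the odd torus `2L+1`, heights `tᵢ + 2 ≤ L` and real coefficients `cᵢ`,
`0 ≤ Σᵢ Σⱼ cᵢ cⱼ · latticeConnectedCorr r.ρ β (2L+1) Q^θ Q (tᵢ + tⱼ)`. [OsterwalderSeiler1978 §2; folklore] -/
theorem AxisCovHankelPSD : open Literature.MathematicalPhysics.QuantumLattice Literature.MathematicalPhysics.AQFT Literature.MathematicalPhysics.QuantumFieldTheory in ∀ (G : Type) [Group G] [TopologicalSpace G] [IsTopologicalGroup G] [CompactSpace G] [MeasurableSpace G] [BorelSpace G] (r : LatticeRep G) (β : ℝ), 0 ≤ β → ∀ (L k : ℕ) (t : Fin k → ℕ) (c : Fin k → ℝ), (∀ i, t i + 2 ≤ L) → 0 ≤ ∑ i, ∑ j, c i * c j * latticeConnectedCorr r.ρ β (2 * L + 1) r.curvature.timeReflect.F r.curvature.F (t i + t j) :=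 by
  intro G _ _ _ _ _ _ r β hβ L k t c ht
  by_cases hk : k = 0
  · subst hk; simp
  obtain ⟨i₀⟩ : Nonempty (Fin k) := Fin.pos_iff_nonempty.1 (Nat.pos_of_ne_zero hk)
  have hL : 1 ≤ L := by have := ht i₀; omega
  haveI := isProbabilityMeasure_wilsonMeasure (d := 4) (L := 2 * L + 1) (G := G) r.ρ r.continuous β
  unfold latticeConnectedCorr
  set Q : LGConfig 4 G → ℝ := r.curvature.F with hQ
  set Qθ : LGConfig 4 G → ℝ := r.curvature.timeReflect.F with hQθ
  obtain ⟨B, hB⟩ := r.curvature.bounded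
  obtain ⟨Bθ, hBθ⟩ := r.curvature.timeReflect.bounded
  rw [← hQ] at hB; rw [← hQθ] at hBθ
  have hB0 : 0 ≤ B := (abs_nonneg _).trans (hB fun _ => 1)
  have hBθ0 : 0 ≤ Bθ := (abs_nonneg _).trans (hBθ fun _ => 1)
  have hlift : Measurable (torusLift (d := 4) (G := G) (2 * L + 1)) := measurable_torusLift _
  have hQm : Measurable Q := r.curvature.measurable
  have hQθm : Measurable Qθ := r.curvature.timeReflect.measurable
  -- generic integrability of bounded measurable observables
  have hI : ∀ f : GaugeConfig 4 (2 * L + 1) G → ℝ, Measurable f → (∃ C, ∀ U, |f U| ≤ C) →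
      Integrable f (wilsonMeasure r.ρ β : Measure (GaugeConfig 4 (2 * L + 1) G)) := fun f hf hb => by
    obtain ⟨C, hC⟩ := hb
    exact Integrable.of_bound hf.aestronglyMeasurable C (ae_of_all _ fun U => by rw [Real.norm_eq_abs]; exact hC U)
  -- the test observable `X = Σ cᵢ Q_{tᵢ e₀} ∘ lift`
  obtain ⟨X, hX⟩ : ∃ X : GaugeConfig 4 (2 * L + 1) G → ℝ,
      X = fun U => ∑ i, c i * Q (configShift (-(Pi.single 0 (t i : ℤ))) (torusLift (2 * L + 1) U)) := ⟨_, rfl⟩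
  have hXi : ∀ x : Literature.Probability.LatticeModels.Site 4, Measurable fun U : GaugeConfig 4 (2 * L + 1) G =>
      Q (configShift (-x) (torusLift (2 * L + 1) U)) := fun x =>
    hQm.comp ((configShift _).measurable.comp hlift)
  have hXθi : ∀ x : Literature.Probability.LatticeModels.Site 4, Measurable fun U : GaugeConfig 4 (2 * L + 1) G =>
      Qθ (configShift (-x) (torusLift (2 * L + 1) U)) := fun x =>
    hQθm.comp ((configShift _).measurable.comp hlift)
  have hXm : Measurable X := by
    rw [hX]; exact Finset.measurable_sum _ fun i _ => (hXi _).const_mul _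
  have hXb : ∃ C : ℝ, ∀ U, |X U| ≤ C := by
    refine ⟨∑ i, |c i| * B, fun U => ?_⟩
    rw [hX]
    refine (Finset.abs_sum_le_sum_abs _ _).trans (Finset.sum_le_sum fun i _ => ?_)
    rw [abs_mul]
    exact mul_le_mul_of_nonneg_left (hB _) (abs_nonneg _)
  have hXd : DependsOn X {e : Edge 4 (2 * L + 1) | (e.1 0).val ≤ L ∧ (e.2 = 0 → (e.1 0).val < L)} := by
    intro U V hUV
    rw [hX]
    refine Finset.sum_congr rfl fun i _ => ?_
    have hd := dependsOn_curv_posHalf r (S := L) (Pi.single 0 (t i : ℤ)) (t := t i) (by simp) (ht i)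
    have hd' := hd hUV
    simp only [] at hd'
    rw [hQ, hd']
  obtain ⟨hpos, -, -⟩ := OddTorusCovCauchySchwarz G r.N r.ρ r.continuous β hβ L hL X X hXm hXm hXb hXb hXd hXd
  -- pointwise expansions
  have eXΘ : ∀ U : GaugeConfig 4 (2 * L + 1) G, X U.negReflect =
      ∑ i, c i * Qθ (configShift (-(-(Pi.single 0 (t i : ℤ)))) (torusLift (2 * L + 1) U)) := by
    intro U; rw [hX]; simp only []
    refine Finset.sum_congr rfl fun i _ => ?_
    rw [hQ, hQθ, curv_shift_lift_negReflect, siteReflect_single_nat]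
  have eX : ∀ U : GaugeConfig 4 (2 * L + 1) G, X U =
      ∑ i, c i * Q (configShift (-(Pi.single 0 (t i : ℤ))) (torusLift (2 * L + 1) U)) := fun U => by rw [hX]
  have eprod : ∀ U : GaugeConfig 4 (2 * L + 1) G, X U.negReflect * X U =
      ∑ i, ∑ j, (c i * c j) * (Qθ (configShift (-(-(Pi.single 0 (t i : ℤ)))) (torusLift (2 * L + 1) U)) *
        Q (configShift (-(Pi.single 0 (t j : ℤ))) (torusLift (2 * L + 1) U))) := by
    intro U
    rw [eXΘ, eX, Finset.sum_mul_sum]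
    exact Finset.sum_congr rfl fun i _ => Finset.sum_congr rfl fun j _ => by ring
  -- (1) the pair integral
  have h1 : ∫ U, X U.negReflect * X U ∂(wilsonMeasure r.ρ β : Measure (GaugeConfig 4 (2 * L + 1) G)) =
      ∑ i, ∑ j, c i * c j * ∫ U, Qθ (torusLift (2 * L + 1) U) *
        Q (configShift (-Pi.single 0 (((t i + t j : ℕ)) : ℤ)) (torusLift (2 * L + 1) U))
          ∂(wilsonMeasure r.ρ β : Measure (GaugeConfig 4 (2 * L + 1) G)) := by
    have hij : ∀ i j, Integrable (fun U : GaugeConfig 4 (2 * L + 1) G =>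
        (c i * c j) * (Qθ (configShift (-(-(Pi.single 0 (t i : ℤ)))) (torusLift (2 * L + 1) U)) *
          Q (configShift (-(Pi.single 0 (t j : ℤ))) (torusLift (2 * L + 1) U))))
        (wilsonMeasure r.ρ β : Measure (GaugeConfig 4 (2 * L + 1) G)) := fun i j =>
      hI _ (((hXθi _).mul (hXi _)).const_mul _) ⟨|c i * c j| * (Bθ * B), fun U => by
        rw [abs_mul]
        refine mul_le_mul_of_nonneg_left ?_ (abs_nonneg _)
        rw [abs_mul]
        exact mul_le_mul (hBθ _) (hB _) (abs_nonneg _) hBθ0⟩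
    simp_rw [eprod]
    rw [integral_finsetSum _ fun i _ => integrable_finsetSum _ fun j _ => hij i j]
    refine Finset.sum_congr rfl fun i _ => ?_
    rw [integral_finsetSum _ fun j _ => hij i j]
    refine Finset.sum_congr rfl fun j _ => ?_
    rw [integral_const_mul, integral_mul_shift_lift, single_sub_neg_single]
  -- (2) the two means
  have h2 : ∫ U, X U ∂(wilsonMeasure r.ρ β : Measure (GaugeConfig 4 (2 * L + 1) G)) =
      (∑ i, c i) * ∫ U, Q (torusLift (2 * L + 1) U) ∂(wilsonMeasure r.ρ β : Measure (GaugeConfig 4 (2 * L + 1) G)) := by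
    simp_rw [eX]
    rw [integral_finsetSum _ fun i _ => ?_, Finset.sum_mul]
    · refine Finset.sum_congr rfl fun i _ => ?_
      rw [integral_const_mul, integral_shift_lift]
    · exact hI _ ((hXi _).const_mul _) ⟨|c i| * B, fun U => by
        rw [abs_mul]; exact mul_le_mul_of_nonneg_left (hB _) (abs_nonneg _)⟩
  have h3 : ∫ U, X U ∂(wilsonMeasure r.ρ β : Measure (GaugeConfig 4 (2 * L + 1) G)) =
      (∑ i, c i) * ∫ U, Qθ (torusLift (2 * L + 1) U) ∂(wilsonMeasure r.ρ β : Measure (GaugeConfig 4 (2 * L + 1) G)) := by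
    rw [← integral_comp_negReflect_eq r.ρ r.continuous β X]
    simp_rw [eXΘ]
    rw [integral_finsetSum _ fun i _ => ?_, Finset.sum_mul]
    · refine Finset.sum_congr rfl fun i _ => ?_
      rw [integral_const_mul, integral_shift_lift]
    · exact hI _ ((hXθi _).const_mul _) ⟨|c i| * Bθ, fun U => by
        rw [abs_mul]; exact mul_le_mul_of_nonneg_left (hBθ _) (abs_nonneg _)⟩
  -- assemble
  have hmeans : (∫ U, X U ∂(wilsonMeasure r.ρ β : Measure (GaugeConfig 4 (2 * L + 1) G))) *
      (∫ U, X U ∂(wilsonMeasure r.ρ β : Measure (GaugeConfig 4 (2 * L + 1) G))) =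
      ∑ i, ∑ j, c i * c j * ((∫ U, Qθ (torusLift (2 * L + 1) U) ∂(wilsonMeasure r.ρ β : Measure (GaugeConfig 4 (2 * L + 1) G))) *
        ∫ U, Q (torusLift (2 * L + 1) U) ∂(wilsonMeasure r.ρ β : Measure (GaugeConfig 4 (2 * L + 1) G))) := by
    nth_rewrite 1 [h3]; rw [h2]
    rw [show ∀ (s A B' : ℝ), s * A * (s * B') = s * s * (A * B') from fun s A B' => by ring, Finset.sum_mul_sum,
      Finset.sum_mul]
    refine Finset.sum_congr rfl fun i _ => ?_
    rw [Finset.sum_mul]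
  rw [h1, hmeans] at hpos
  have hsplit : ∑ i, ∑ j, c i * c j * ((∫ U, Qθ (torusLift (2 * L + 1) U) *
        Q (configShift (-Pi.single 0 (((t i + t j : ℕ)) : ℤ)) (torusLift (2 * L + 1) U))
          ∂(wilsonMeasure r.ρ β : Measure (GaugeConfig 4 (2 * L + 1) G))) -
        (∫ U, Qθ (torusLift (2 * L + 1) U) ∂(wilsonMeasure r.ρ β : Measure (GaugeConfig 4 (2 * L + 1) G))) *
          ∫ U, Q (torusLift (2 * L + 1) U) ∂(wilsonMeasure r.ρ β : Measure (GaugeConfig 4 (2 * L + 1) G))) =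
      (∑ i, ∑ j, c i * c j * ∫ U, Qθ (torusLift (2 * L + 1) U) *
        Q (configShift (-Pi.single 0 (((t i + t j : ℕ)) : ℤ)) (torusLift (2 * L + 1) U))
          ∂(wilsonMeasure r.ρ β : Measure (GaugeConfig 4 (2 * L + 1) G))) -
      ∑ i, ∑ j, c i * c j * ((∫ U, Qθ (torusLift (2 * L + 1) U) ∂(wilsonMeasure r.ρ β : Measure (GaugeConfig 4 (2 * L + 1) G))) *
        ∫ U, Q (torusLift (2 * L + 1) U) ∂(wilsonMeasure r.ρ β : Measure (GaugeConfig 4 (2 * L + 1) G))) := by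
    simp only [mul_sub, Finset.sum_sub_distrib]
  rw [hsplit]
  exact hpos

end Summit.QuantumFields.YangMills.Theorems.CurvatureKernel

end
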